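/-
Copyright (c) 2026 the pub-hodgecm-mathlib formalisation cell (harness21).  Prover seat hodgecm-mathlib-K2E5-p09 (g0),
Track B «K2-LIT» ∕ h413, engine E5 «TamagawaUnitary», unit DET-SECTION (archimedean factor), file B9 (deal K2E5-plan BATCH #4bis
2026-09-03T22:12∕22:22Z (i′), co-hand of defs leaf #3e-β): `archDetU : U(h)(L ⊗ ℝ) → U(1)(L ⊗ ℝ)` IS SURJECTIVE, OPEN, WITH CLOSED KERNEL —
by the archimedean quasi-reflection section.  2026-09-03.
-/
import Summits.HodgeConjecture.HodgeConjecture.Theorems.K2E5SUAdelicStructureDefs       -- ★ #3b K2E5-p07: `archDetU`, `continuous_archDetU`, `coe_coe_archDetU_apply`, `map_det_mul_det_eq_one`, `isUnit_det_archFormOf`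
import Summits.HodgeConjecture.HodgeConjecture.Theorems.K2E5DetRationalSurjective        -- ★ B2 K2E5-p09: `exists_anisotropic_fin_two` (an anisotropic vector of a hermitian plane)
import Summits.HodgeConjecture.HodgeConjecture.Theorems.K2E5HaarIsOpenMapOfSection       -- ★ A1 K2E5-p01: `isOpenMapOfSection` (a homomorphism with a continuous section is open)
import Literature.NumberTheory.Automorphic.UnitaryGroupArchimedeanPlaces               -- ★ `UnitaryGroup.conjMixed_mixedEmbedding`
import HarnessLib

/-!
# K2_E5 road (h413 = stmt-HodgeConjecture-24833), unit DET-SECTION, archimedean factor, file B9: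
# `det : U(h)(L ⊗ ℝ) → U(1)(L ⊗ ℝ)` has a continuous homomorphic section; it is surjective and open, with closed kernel `SU(h)(L ⊗ ℝ)`

Cell `pub/hodgecm-mathlib` (D-0151), Track B (21-frontier RULING «PUSH BOTH» 2026-09-03, director req624, chair K2-lead ORDER #1 §4.4 ∕
ORDER #2).  Dealt BY NAME (K2E5-plan DEALS E5 BATCH #4bis (i′), 2026-09-03T22:22:17Z) as the archimedean analogue of socket B4
`sig_K2E5DetUSurjectiveOpen` (★ `Theorems/K2E5DetUSurjectiveOpen`), input of the ARCH-PINNED `SU(h)_∞`-measure of defs leaf #3e-β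
(`suArchPinned`, K2E5-p04) through ★ A5 `K2E5HaarKerPinRescale.haarKerPinRescale` (which wants `φ` continuous, open, surjective, with closed kernel).

THE MATHEMATICS [PlatonovRapinchuk1994, §2.3 (unitary groups: `U(h) ∕ SU(h) ≅ U(1)` split by a one-dimensional torus), §3.2 (real points)]
[Rogawski1990, §3.1 p. 19 (the groups `U(h)(F_v)` at archimedean `v`)] [VignerasLNM800, Ch. II §4 («Mesures compatibles»: a homomorphism with a
continuous section is open)].  Let `L` be a CM field, `L⁺` its maximal totally real subfield, `c` complex conjugation, `R = L ⊗_ℚ ℝ` (Mathlib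
`mixedSpace L`) with the involution `σ = c ⊗ 1` (★ `UnitaryGroup.conjMixed`), and `h ∈ M₂(L)` hermitian non-degenerate with archimedean form
`H = h ⊗ 1` (★ `archFormOf`).  Pick an anisotropic vector `v₀ ∈ L²` of `h` (★ B2 `exists_anisotropic_fin_two`: `q₀ = v̄₀ᵀ h v₀ ≠ 0`) and put
`v = v₀ ⊗ 1`, `w = v̄ᵀ H`, `q = w v = q₀ ⊗ 1` — a UNIT of `R`.  The quasi-reflections `S(z) = 1 + (z − 1) q⁻¹ · v w` (`z ∈ R`) satisfy
`S(z z′) = S(z) S(z′)`, `S(1) = 1`, `det S(z) = z`, and `S(z)̄ᵀ H S(z) = H` whenever `σ(z) z = 1` — the SAME identities as in ★ B2 §1, here over the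
commutative ring `R` with `q⁻¹` the inverse of a unit (§1 below re-proves B2's field-level §1 at this generality).  Hence
`u ↦ S(det u) : U(1)(R) →* U(H)(R)` is a continuous homomorphic SECTION of `archDetU = det` (§2: `exists_unitarySection`, generic over any
topological commutative ring; §3: `archDetSection`), so `archDetU` is surjective, OPEN (★ A1 `isOpenMapOfSection`), and its kernel
`SU(h)(L ⊗ ℝ)` is closed (preimage of the closed point `1` of the Hausdorff group `U(1)(L ⊗ ℝ)`).

* §1 generic quasi-reflection algebra over a commutative ring `R` with an endomorphism `σ` (ring-level forms of ★ B2 §1; cf. the `σ`-FIXED-vector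
  variants ★ `UnitaryGroup.reflMatrix_mul_reflMatrix` ∕ `transpose_map_reflMatrix_mul` of `UnitaryGroupLocalReflections`, which do not cover a
  non-`σ`-fixed anisotropic vector): `one_add_smul_vecMulVec_mul`, `conj_gramRow_apply`, `conjTranspose_quasiReflection_mul`;
* §2 `exists_unitarySection` — for `R` a topological commutative ring, `σ` involutive, `H` `σ`-hermitian, `v` with UNIT Gram value and any rank-one
  form `J₁` with unit determinant: a continuous homomorphism `s : U(σ, J₁)(R) →* U(σ, H)(R)` (★ `unitaryGroupOfForm`) with `det (s u) = det u`;
* §3 the CM ∕ archimedean instantiation: `conjMixed_conjMixed`, `archFormOf_hermitian`, `archGram_isUnit` (the Gram value of `v₀ ⊗ 1` is `q₀ ⊗ 1`, a unit),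
  **`archDetSection`** (`∃ s : U(1)(L ⊗ ℝ) →* U(h)(L ⊗ ℝ)` continuous with `archDetU ∘ s = id`; the arch analogue of socket B3) and the head
  **`archDetUSurjectiveOpen`** (`archDetU` surjective ∧ open ∧ closed kernel; the arch analogue of socket B4).

HONEST LABEL.  HC_CM is proved only modulo the 7 printed citations (2 remaining named inputs: hLiu418 = `stmt-HodgeConjecture-24832`, h413 =
`stmt-HodgeConjecture-24833`) until rung 0 closes; this file is a `--supports stmt-HodgeConjecture-24833 --as helper` payment and moves no counter.

## References
* [PlatonovRapinchuk1994] V. Platonov, A. Rapinchuk, *Algebraic Groups and Number Theory*, Pure Appl. Math. 139, Academic Press (1994) — §2.3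
  (unitary groups of hermitian forms; `det : U(h) → U(1)` split by the torus fixing an anisotropic line's orthogonal complement), §3.2 (archimedean points).
* [Rogawski1990] J. D. Rogawski, *Automorphic Representations of Unitary Groups in Three Variables*, Ann. of Math. Stud. 123 (1990) — §3.1 p. 19.
* [VignerasLNM800] M.-F. Vignéras, *Arithmétique des algèbres de quaternions*, LNM 800 (1980) — Ch. II §4 («Mesures compatibles»).
-/

set_option autoImplicit false
-- the mandated namespace repeats the single-problem summit's segment (`HodgeConjecture.HodgeConjecture`)
set_option linter.dupNamespace false

noncomputable section

open NumberField

namespace Summit.HodgeConjecture.HodgeConjecture.Cruxes.H413.K2E5ArchDetUSurjectiveOpen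

open Matrix Literature.NumberTheory.Automorphic
open Summit.HodgeConjecture.HodgeConjecture.Cruxes.H413.K2E5SUAdelicStructureDefs

/-! ## §1 Generic quasi-reflection algebra over a commutative ring -/

section Generic

variable {R : Type*} [CommRing R] {n : Type*} [Fintype n] [DecidableEq n]

/-- **product of two quasi-reflections along the same pair `(v, w)`** (commutative ring): `(1 + a V)(1 + b V) = 1 + (a + b + a b q) V` for `V = v wᵀ`,
`q = wᵀ v`, because `V² = q V`.  (Ring-level form of ★ B2 `K2E5DetRationalSurjective.one_add_smul_vecMulVec_mul`.) [folklore] -/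
theorem one_add_smul_vecMulVec_mul (v w : n → R) (a b : R) :
    (1 + a • vecMulVec v w) * (1 + b • vecMulVec v w) = 1 + (a + b + a * b * (w ⬝ᵥ v)) • vecMulVec v w := by
  have hVV : vecMulVec v w * vecMulVec v w = (w ⬝ᵥ v) • vecMulVec v w := by
    rw [vecMulVec_mul_vecMulVec, vecMulVec_smul]
  simp only [add_mul, mul_add, one_mul, mul_one, smul_mul_assoc, mul_smul_comm, smul_smul, hVV]
  module

variable (σ : R →+* R) (H : Matrix n n R) (v : n → R)

omit [DecidableEq n] in
/-- For an involutive `σ` and a `σ`-hermitian `H`, the conjugate of the Gram row `w = v̄ᵀ H` is the column `H v`, entrywise: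
`σ (w j) = (H v) j` (commutative ring; the function-level, field-level form is ★ B2 `K2E5DetRationalSurjective.conj_gramRow`). [folklore] -/
theorem conj_gramRow_apply (hσ : ∀ x, σ (σ x) = x) (hH : (H.map σ)ᵀ = H) (j : n) :
    σ (((⇑σ ∘ v) ᵥ* H) j) = (H *ᵥ v) j := by
  have hHt : H.map σ = Hᵀ := by simpa only [transpose_transpose] using congrArg transpose hH
  have hvv : (⇑σ ∘ (⇑σ ∘ v)) = v := funext fun i => hσ (v i)
  rw [RingHom.map_vecMul, hvv, hHt, vecMul_transpose]

/-- **adjoint identity for a quasi-reflection** (commutative ring): with `w = v̄ᵀ H`, `q = w v`,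
`(1 + a v w)̄ᵀ · H · (1 + a v w) = H + (σ a + a + σ a · a · q) · (H v) w`. [folklore] -/
theorem conjTranspose_quasiReflection_mul (hσ : ∀ x, σ (σ x) = x) (hH : (H.map σ)ᵀ = H) (a : R) :
    ((1 + a • vecMulVec v ((⇑σ ∘ v) ᵥ* H)).map σ)ᵀ * H * (1 + a • vecMulVec v ((⇑σ ∘ v) ᵥ* H)) =
      H + (σ a + a + σ a * a * (((⇑σ ∘ v) ᵥ* H) ⬝ᵥ v)) • vecMulVec (H *ᵥ v) ((⇑σ ∘ v) ᵥ* H) := by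
  set w : n → R := (⇑σ ∘ v) ᵥ* H with hw
  have hcw : (⇑σ ∘ w) = H *ᵥ v := funext fun j => conj_gramRow_apply σ H v hσ hH j
  have hmapV : (vecMulVec v w).map σ = vecMulVec (⇑σ ∘ v) (⇑σ ∘ w) := by
    ext i j
    simp only [map_apply, vecMulVec_apply, map_mul, Function.comp_apply]
  have hct : ((1 + a • vecMulVec v w).map σ)ᵀ = 1 + σ a • vecMulVec (H *ᵥ v) (⇑σ ∘ v) := by
    rw [Matrix.map_add _ (map_add σ), Matrix.map_one _ (map_zero σ) (map_one σ), Matrix.map_smul' _ _ _ (map_mul σ), hmapV,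
      hcw, transpose_add, transpose_one, transpose_smul, transpose_vecMulVec]
  have hVV : vecMulVec (H *ᵥ v) w * vecMulVec v w = (w ⬝ᵥ v) • vecMulVec (H *ᵥ v) w := by
    rw [vecMulVec_mul_vecMulVec, vecMulVec_smul]
  rw [hct]
  simp only [add_mul, mul_add, one_mul, mul_one, smul_mul_assoc, mul_smul_comm, smul_smul, vecMulVec_mul, mul_vecMulVec, ← hw,
    hVV]
  module

end Generic

/-! ## §2 The quasi-reflection section of `det` on unitary groups over a topological commutative ring -/

section Section

variable {R : Type*} [CommRing R] [TopologicalSpace R] [IsTopologicalRing R] {n : Type*} [Fintype n] [DecidableEq n]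
  (σ : R →+* R) (H : Matrix n n R) (v : n → R)

/-- **the unitary section of `det` along a vector with unit Gram value**: for `σ` involutive, `H` `σ`-hermitian, `v` with `q = v̄ᵀ H v` a UNIT, and
any rank-one form `J₁` with unit determinant, `u ↦ S(det u) = 1 + (det u − 1) q⁻¹ · v (v̄ᵀ H)` is a CONTINUOUS homomorphism
`U(σ, J₁)(R) →* U(σ, H)(R)` (★ `unitaryGroupOfForm`) with `det S(det u) = det u` (`σ(det u) · det u = 1` for `u ∈ U(σ, J₁)`, ★ #3b `map_det_mul_det_eq_one`).
[cite: PlatonovRapinchuk1994, §2.3 (unitary groups)] -/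
theorem exists_unitarySection (hσ : ∀ x, σ (σ x) = x) (hH : (H.map σ)ᵀ = H) (hq : IsUnit (((⇑σ ∘ v) ᵥ* H) ⬝ᵥ v))
    (J₁ : Matrix (Fin 1) (Fin 1) R) (hJ₁ : IsUnit J₁.det) :
    ∃ s : unitaryGroupOfForm σ J₁ →* unitaryGroupOfForm σ H,
      Continuous s ∧ ∀ u, (((s u : unitaryGroupOfForm σ H) : GL n R) : Matrix n n R).det = ((u : GL (Fin 1) R) : Matrix (Fin 1) (Fin 1) R).det := by
  obtain ⟨qu, hqu⟩ := hq
  set w : n → R := (⇑σ ∘ v) ᵥ* H with hw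
  set qi : R := ↑qu⁻¹ with hqi
  have hqqi : (w ⬝ᵥ v) * qi = 1 := by rw [← hqu]; exact qu.mul_inv
  -- the multiplicative family of quasi-reflections `S : R →* M_n(R)`
  let S : R →* Matrix n n R :=
    { toFun := fun z => 1 + ((z - 1) * qi) • vecMulVec v w
      map_one' := by simp
      map_mul' := fun z z' => by
        have ha : (z * z' - 1) * qi = (z - 1) * qi + (z' - 1) * qi + ((z - 1) * qi) * ((z' - 1) * qi) * (w ⬝ᵥ v) := by
          linear_combination (-(z - 1) * (z' - 1) * qi) * hqqi
        show 1 + ((z * z' - 1) * qi) • vecMulVec v w = (1 + ((z - 1) * qi) • vecMulVec v w) * (1 + ((z' - 1) * qi) • vecMulVec v w)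
        rw [one_add_smul_vecMulVec_mul, ← ha] }
  have hS : ∀ z, S z = 1 + ((z - 1) * qi) • vecMulVec v w := fun z => rfl
  have hSc : Continuous S := by
    show Continuous fun z : R => 1 + ((z - 1) * qi) • vecMulVec v w
    exact continuous_const.add (((continuous_id.sub continuous_const).mul continuous_const).smul continuous_const)
  -- `det` on `GL₁(R)` is continuous (both coordinates of the unit are determinants of continuous matrix-valued maps)
  have hdetc : Continuous (Matrix.GeneralLinearGroup.det : GL (Fin 1) R → Rˣ) :=
    Units.continuous_iff.2 ⟨Units.continuous_val.matrix_det, Units.continuous_coe_inv.matrix_det⟩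
  -- the `GL_n(R)`-valued homomorphism `u ↦ S(det u)` on `U(σ, J₁)(R)`
  let t : unitaryGroupOfForm σ J₁ →* GL n R :=
    (Units.map S).comp (Matrix.GeneralLinearGroup.det.comp (unitaryGroupOfForm σ J₁).subtype)
  have ht : ∀ u, ((t u : GL n R) : Matrix n n R) = 1 + ((((u : GL (Fin 1) R) : Matrix (Fin 1) (Fin 1) R).det - 1) * qi) • vecMulVec v w :=
    fun u => rfl
  -- its values are `H`-unitary: the adjoint identity with coefficient `σ a + a + σ a · a · q = 0` for `σ z · z = 1`
  have hσq : σ (w ⬝ᵥ v) = w ⬝ᵥ v := by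
    have hcw : (⇑σ ∘ w) = H *ᵥ v := funext fun j => conj_gramRow_apply σ H v hσ hH j
    rw [RingHom.map_dotProduct, hcw, dotProduct_comm, dotProduct_mulVec]
  have hσqi : σ qi = qi := by
    have h1 : σ qi * (w ⬝ᵥ v) = 1 := by rw [← hσq, ← map_mul, mul_comm, hqqi, map_one]
    calc σ qi = σ qi * ((w ⬝ᵥ v) * qi) := by rw [hqqi, mul_one]
      _ = (σ qi * (w ⬝ᵥ v)) * qi := by ring
      _ = qi := by rw [h1, one_mul]
  have hmem : ∀ u, t u ∈ unitaryGroupOfForm σ H := fun u => by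
    rw [mem_unitaryGroupOfForm_iff, ht]
    set z : R := ((u : GL (Fin 1) R) : Matrix (Fin 1) (Fin 1) R).det with hz
    have hzz : σ z * z = 1 := map_det_mul_det_eq_one σ J₁ hJ₁ u
    have hcoef : σ ((z - 1) * qi) + (z - 1) * qi + σ ((z - 1) * qi) * ((z - 1) * qi) * (w ⬝ᵥ v) = 0 := by
      rw [map_mul, map_sub, map_one, hσqi]
      linear_combination qi * hzz + ((σ z - 1) * (z - 1) * qi) * hqqi
    rw [hw, conjTranspose_quasiReflection_mul σ H v hσ hH, ← hw, hcoef, zero_smul, add_zero]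
  refine ⟨t.codRestrict _ hmem, ?_, fun u => ?_⟩
  · -- continuity of the section
    refine Continuous.subtype_mk ?_ _
    show Continuous fun u => t u
    exact (Continuous.units_map S hSc).comp (hdetc.comp continuous_subtype_val)
  · -- `det S(det u) = 1 + (det u − 1) q⁻¹ q = det u`
    show ((t u : GL n R) : Matrix n n R).det = _
    -- matrix-determinant lemma (Mathlib `det_one_add_replicateCol_mul_replicateRow`; the named form is ★ `UnitaryGroup.LocalRankThree.det_reflMatrix`)
    rw [ht, ← smul_vecMulVec, vecMulVec_eq (ι := Unit), det_one_add_replicateCol_mul_replicateRow, dotProduct_smul, smul_eq_mul]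
    linear_combination ((((u : GL (Fin 1) R) : Matrix (Fin 1) (Fin 1) R).det) - 1) * hqqi

end Section

/-! ## §3 The archimedean instantiation: `det : U(h)(L ⊗ ℝ) → U(1)(L ⊗ ℝ)` for a hermitian plane over a CM field -/

section Arch

open NumberField.mixedEmbedding

variable (L : Type) [Field L] [NumberField L] [IsCMField L]

/-- `c ⊗ 1` is an involution of `L ⊗ ℝ` (transport of `c ∘ c = id` along ★ `conjMixed_ringEquiv`; the pointwise variant used by the arch files).
[folklore] -/
theorem conjMixed_conjMixed (x : mixedSpace L) :
    UnitaryGroup.conjMixed (↥(maximalRealSubfield L)) L (IsCMField.complexConj L)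
        (UnitaryGroup.conjMixed (↥(maximalRealSubfield L)) L (IsCMField.complexConj L) x) = x := by
  have hcc : IsCMField.complexConj L * IsCMField.complexConj L = 1 :=
    AlgEquiv.ext fun y => by rw [AlgEquiv.mul_apply, IsCMField.complexConj_apply_apply]; rfl
  obtain ⟨y, rfl⟩ := (InfiniteAdeleRing.ringEquiv_mixedSpace L).surjective x
  rw [UnitaryGroup.conjMixed_ringEquiv, UnitaryGroup.conjMixed_ringEquiv, smul_smul, hcc, one_smul]

variable (Ha : Matrix (Fin 2) (Fin 2) L)

/-- The archimedean form `h ⊗ 1` (★ `archFormOf`) is `(c ⊗ 1)`-hermitian when `h` is `c`-hermitian (entrywise ★ `conjMixed_mixedEmbedding`). [folklore] -/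
theorem archFormOf_hermitian (hHa : (Ha.map (cmConjRingHom L)).transpose = Ha) :
    ((UnitaryGroup.archFormOf L 2 Ha).map (UnitaryGroup.conjMixed (↥(maximalRealSubfield L)) L (IsCMField.complexConj L)))ᵀ =
      UnitaryGroup.archFormOf L 2 Ha := by
  rw [UnitaryGroup.archFormOf, Matrix.map_map]
  have hcomp : (UnitaryGroup.conjMixed (↥(maximalRealSubfield L)) L (IsCMField.complexConj L) : mixedSpace L → mixedSpace L) ∘
      (mixedEmbedding L : L → mixedSpace L) = (mixedEmbedding L : L → mixedSpace L) ∘ (cmConjRingHom L : L → L) := by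
    funext x
    simp only [Function.comp_apply, UnitaryGroup.conjMixed_mixedEmbedding, cmConjRingHom_apply]
  rw [hcomp, ← Matrix.map_map, ← Matrix.transpose_map]
  exact congrArg (fun M : Matrix (Fin 2) (Fin 2) L => M.map (mixedEmbedding L)) hHa

/-- The Gram value of `v₀ ⊗ 1` for the archimedean form is `q₀ ⊗ 1` (`q₀ = v̄₀ᵀ h v₀`): the embedding `mixedEmbedding` is a ring homomorphism
intertwining `c` and `c ⊗ 1`. [folklore] -/
theorem archGram_eq (v₀ : Fin 2 → L) :
    ((⇑(UnitaryGroup.conjMixed (↥(maximalRealSubfield L)) L (IsCMField.complexConj L)) ∘ (⇑(mixedEmbedding L) ∘ v₀)) ᵥ*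
          UnitaryGroup.archFormOf L 2 Ha) ⬝ᵥ (⇑(mixedEmbedding L) ∘ v₀) =
      mixedEmbedding L (((⇑(cmConjRingHom L) ∘ v₀) ᵥ* Ha) ⬝ᵥ v₀) := by
  have hcomp : (⇑(UnitaryGroup.conjMixed (↥(maximalRealSubfield L)) L (IsCMField.complexConj L)) ∘ (⇑(mixedEmbedding L) ∘ v₀)) =
      ⇑(mixedEmbedding L) ∘ (⇑(cmConjRingHom L) ∘ v₀) := by
    funext i
    simp only [Function.comp_apply, UnitaryGroup.conjMixed_mixedEmbedding, cmConjRingHom_apply]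
  have hrow : (⇑(mixedEmbedding L) ∘ (⇑(cmConjRingHom L) ∘ v₀)) ᵥ* UnitaryGroup.archFormOf L 2 Ha =
      ⇑(mixedEmbedding L) ∘ ((⇑(cmConjRingHom L) ∘ v₀) ᵥ* Ha) := by
    funext j
    rw [UnitaryGroup.archFormOf, Function.comp_apply, RingHom.map_vecMul]
  rw [hcomp, hrow, RingHom.map_dotProduct]

/-- **the archimedean det-section** (arch analogue of socket B3 `sig_K2E5DetAdelicSection`): for a non-degenerate hermitian PLANE `h` over a CM
field `L` there is a continuous homomorphism `s : U(1)(L ⊗ ℝ) →* U(h)(L ⊗ ℝ)` with `archDetU ∘ s = id` — the quasi-reflection section along an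
anisotropic vector `v₀ ⊗ 1` (★ B2 `exists_anisotropic_fin_two`, §2 `exists_unitarySection`). [cite: PlatonovRapinchuk1994, §2.3 (unitary groups), §3.2] -/
theorem archDetSection (hHa : (Ha.map (cmConjRingHom L)).transpose = Ha) (hdet : Ha.det ≠ 0) :
    ∃ s : ↥(UnitaryGroup.arch (↥(maximalRealSubfield L)) L (IsCMField.complexConj L) 1 (1 : Matrix (Fin 1) (Fin 1) L)) →*
        ↥(UnitaryGroup.arch (↥(maximalRealSubfield L)) L (IsCMField.complexConj L) 2 Ha),
      Continuous s ∧ ∀ u, UnitaryGroup.archDetU (↥(maximalRealSubfield L)) L (IsCMField.complexConj L) 2 Ha hdet (s u) = u := by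
  obtain ⟨v₀, hv₀⟩ := K2E5DetRationalSurjective.exists_anisotropic_fin_two (cmConjRingHom L) Ha hHa hdet
  have hq : IsUnit (((⇑(UnitaryGroup.conjMixed (↥(maximalRealSubfield L)) L (IsCMField.complexConj L)) ∘ (⇑(mixedEmbedding L) ∘ v₀)) ᵥ*
        UnitaryGroup.archFormOf L 2 Ha) ⬝ᵥ (⇑(mixedEmbedding L) ∘ v₀)) := by
    rw [archGram_eq]
    exact (IsUnit.mk0 _ hv₀).map _
  -- `arch F E c N J` is by definition `unitaryGroupOfForm (conjMixed F E c) (archFormOf E N J)`: §2 applies verbatim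
  obtain ⟨s, hsc, hsdet⟩ :
      ∃ s : ↥(UnitaryGroup.arch (↥(maximalRealSubfield L)) L (IsCMField.complexConj L) 1 (1 : Matrix (Fin 1) (Fin 1) L)) →*
          ↥(UnitaryGroup.arch (↥(maximalRealSubfield L)) L (IsCMField.complexConj L) 2 Ha),
        Continuous s ∧ ∀ u, (((s u : ↥(UnitaryGroup.arch (↥(maximalRealSubfield L)) L (IsCMField.complexConj L) 2 Ha)) :
            GL (Fin 2) (mixedSpace L)) : Matrix (Fin 2) (Fin 2) (mixedSpace L)).det =
          ((u : GL (Fin 1) (mixedSpace L)) : Matrix (Fin 1) (Fin 1) (mixedSpace L)).det :=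
    exists_unitarySection (UnitaryGroup.conjMixed (↥(maximalRealSubfield L)) L (IsCMField.complexConj L))
      (UnitaryGroup.archFormOf L 2 Ha) (⇑(mixedEmbedding L) ∘ v₀) (conjMixed_conjMixed L) (archFormOf_hermitian L Ha hHa) hq
      (UnitaryGroup.archFormOf L 1 (1 : Matrix (Fin 1) (Fin 1) L))
      (K2E5SUAdelicStructureDefs.UnitaryGroup.isUnit_det_archFormOf L 1 _ (UnitaryGroup.det_one_fin_one_ne_zero L))
  refine ⟨s, hsc, fun u => Subtype.ext <| Matrix.GeneralLinearGroup.ext fun i j => ?_⟩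
  rw [UnitaryGroup.coe_coe_archDetU_apply, hsdet u, Matrix.det_fin_one, Subsingleton.elim i 0, Subsingleton.elim j 0]

/-- **`archDetU` is surjective and open, with closed kernel** (arch analogue of socket B4 `sig_K2E5DetUSurjectiveOpen`): for a non-degenerate
hermitian PLANE `h` over a CM field `L`, `det : U(h)(L ⊗ ℝ) → U(1)(L ⊗ ℝ)` (★ #3b `archDetU`) is SURJECTIVE (the section of `archDetSection`), an
OPEN MAP (★ A1 `isOpenMapOfSection`: continuous homomorphism with a continuous homomorphic section), and `ker det = SU(h)(L ⊗ ℝ)` is CLOSED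
(preimage of the closed point `1` of the Hausdorff group `U(1)(L ⊗ ℝ)` under the continuous ★ `continuous_archDetU`).
[cite: PlatonovRapinchuk1994, §2.3 (unitary groups), §3.2] [cite: VignerasLNM800, Ch. II §4 («Mesures compatibles»)] -/
theorem archDetUSurjectiveOpen :
    ∀ (L : Type) [Field L] [NumberField L] [IsCMField L]
      (Ha : Matrix (Fin 2) (Fin 2) L) (_ : (Ha.map (cmConjRingHom L)).transpose = Ha) (hdet : Ha.det ≠ 0),
      Function.Surjective (UnitaryGroup.archDetU (↥(maximalRealSubfield L)) L (IsCMField.complexConj L) 2 Ha hdet) ∧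
      IsOpenMap (UnitaryGroup.archDetU (↥(maximalRealSubfield L)) L (IsCMField.complexConj L) 2 Ha hdet) ∧
      IsClosed (((UnitaryGroup.archDetU (↥(maximalRealSubfield L)) L (IsCMField.complexConj L) 2 Ha hdet).ker :
          Subgroup ↥(UnitaryGroup.arch (↥(maximalRealSubfield L)) L (IsCMField.complexConj L) 2 Ha)) :
        Set ↥(UnitaryGroup.arch (↥(maximalRealSubfield L)) L (IsCMField.complexConj L) 2 Ha)) := by
  intro L _ _ _ Ha hHa hdet
  obtain ⟨s, hsc, hsu⟩ := archDetSection L Ha hHa hdet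
  refine ⟨fun u => ⟨s u, hsu u⟩, ?_, ?_⟩
  · exact K2E5HaarIsOpenMapOfSection.isOpenMapOfSection _ (UnitaryGroup.continuous_archDetU _ L _ 2 Ha hdet) s hsc hsu
  · rw [MonoidHom.coe_ker]
    exact isClosed_singleton.preimage (UnitaryGroup.continuous_archDetU _ L _ 2 Ha hdet)

end Arch

end Summit.HodgeConjecture.HodgeConjecture.Cruxes.H413.K2E5ArchDetUSurjectiveOpen

end
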